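import Literature.Probability.RandomPlanarGeometry.SAWKestenPatterns
import Mathlib.Algebra.Order.Chebyshev
import HarnessLib

/-!
# CriticalPhenomena/PercolationContinuityZ3 — Theorems/PercNearOneGluingNoHeavyPcintPriceLawEngine.lean:
# Kesten's inequality (Madras–Slade Theorem 7.3.2) for a GRADED swap-closed family of self-avoiding walks

Lane prim-pcint (paper-2 track (iii)), STRUCTURE conjecture **C3 (i) PRICE LAW** (`MemoryTail.priceLaw`,
`…PcintClassCountLaw.lean`): `memStates d (2m+2) / memStates d (2m) → μ(ℤ^d)²`.  By the census identity
(`…PcintMemAutomatonCensusSum`) the states of the memory-`τ` automaton are the NEAR self-avoiding walks: pairs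
`(m, ω)`, `ω` an `m`-step SAW from `0` with `m + ‖ω(m)‖₁ ≤ τ`.  Kesten's swap of an occurrence of the pattern
`(U,Q)` into one of `(V,Q)` (tree: `SAW.Zd.insV` / `delV`, `SAWKestenPatterns.lean`) adds two steps and KEEPS THE
ENDPOINT, hence maps the near family of memory `2k` into that of memory `2k+2`: the family is swap-closed, but it is
GRADED — its members have all lengths `m < 2k` — so the tree's engine `SAW.Zd.thm732W_of_bounds_eventually`
(families `W_N ⊆ S_N` of a single length) does not apply verbatim.  This file is that engine for graded families
`S k ⊆ ℕ × (ℕ → ℤ^{d+2})` (pairs (length, vertex function)): the printed double counting (7.3.6)–(7.3.8) and the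
assembly (7.3.4), with the member's own length in `uCount`/`vCount`/`OccU`, the level `k` in the role of `N`, and
— exactly as in the tree's engine — the `Ξ`-input (few members poor in `(V,Q)`) and the `S_N`-term as hypotheses.
Nothing new mathematically; everything proved.

Source: N. Madras, G. Slade, *The Self-Avoiding Walk* (1993), §7.3, proof of Theorem 7.3.2, eqs. (7.3.4)–(7.3.12)
[MadrasSlade1993].  Written by prim-pcint-2 gen 14 (prover-prim-pcint-2-g14-0), 2026-08-23.
-/

noncomputable section

open Filter Topology Literature.Probability.LatticeModels
open Literature.Probability.RandomPlanarGeometry.SAW.Zd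
open scoped BigOperators

namespace Summit.CriticalPhenomena.PercolationContinuityZ3.Theorems.Pcint.MemoryTail

variable {d : ℕ}

section Graded

open scoped Classical

variable {S : ℕ → Finset (ℕ × (ℕ → Site (d + 2)))} {k : ℕ}

/-! ### Pairs (member, occurrence step) at one level -/

/-- Membership in the set of allowed pairs `((m,ω), i)` of level `k` (a member and an occurrence step of `(U,Q)`; lengths at
level `k` are `< 2k`, so `i < 2k`). [cite: MadrasSlade1993, Theorem 7.3.2 (proof)] -/
theorem mem_uPairsG (hlen : ∀ p ∈ S k, p.1 + 1 ≤ 2 * k) {q : (ℕ × (ℕ → Site (d + 2))) × ℕ} :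
    q ∈ ((S k ×ˢ Finset.range (2 * k)).filter fun q => OccU q.1.1 q.1.2 q.2) ↔ q.1 ∈ S k ∧ OccU q.1.1 q.1.2 q.2 := by
  rw [Finset.mem_filter, Finset.mem_product, Finset.mem_range]
  refine ⟨fun h => ⟨h.1.1, h.2⟩, fun h => ⟨⟨h.1, ?_⟩, h.2⟩⟩
  have h1 := hlen q.1 h.1
  have h2 := h.2.1
  omega

/-- Membership in the set of `V`-pairs of level `k` (a member and an occurrence step of `(V,Q)`). [cite: MadrasSlade1993, Theorem 7.3.2 (proof)] -/
theorem mem_vPairsG (hlen : ∀ p ∈ S k, p.1 + 1 ≤ 2 * k) {q : (ℕ × (ℕ → Site (d + 2))) × ℕ} :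
    q ∈ ((S k ×ˢ Finset.range (2 * k)).filter fun q => OccV q.1.1 q.1.2 q.2) ↔ q.1 ∈ S k ∧ OccV q.1.1 q.1.2 q.2 := by
  rw [Finset.mem_filter, Finset.mem_product, Finset.mem_range]
  refine ⟨fun h => ⟨h.1.1, h.2⟩, fun h => ⟨⟨h.1, ?_⟩, h.2⟩⟩
  have h1 := hlen q.1 h.1
  have h2 := h.2.1
  omega

/-- At level `k` the occurrence steps of `(U,Q)` on a member all lie below `2k`. [folklore] -/
theorem filter_range_occU_eq_uSites {m : ℕ} {ω : ℕ → Site (d + 2)} (hm : m + 1 ≤ 2 * k) :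
    (Finset.range (2 * k)).filter (OccU m ω) = uSites m ω := by
  ext i
  rw [Finset.mem_filter, Finset.mem_range, mem_uSites]
  refine ⟨fun h => h.2, fun h => ⟨?_, h⟩⟩
  have := h.1
  omega

/-- At level `k` the occurrence steps of `(V,Q)` on a member all lie below `2k`. [folklore] -/
theorem filter_range_occV_eq_vSites {m : ℕ} {ω : ℕ → Site (d + 2)} (hm : m + 1 ≤ 2 * k) :
    (Finset.range (2 * k)).filter (OccV m ω) = vSites m ω := by
  ext i
  rw [Finset.mem_filter, Finset.mem_range, mem_vSites]
  refine ⟨fun h => h.2, fun h => ⟨?_, h⟩⟩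
  have := h.1
  omega

/-- Summing over allowed pairs is summing `I · F` over members (`I(m,ω) = uCount m ω`).
[cite: MadrasSlade1993, Theorem 7.3.2 (proof, "Counting the number of allowed pairs in two ways")] -/
theorem sum_uPairsG (hlen : ∀ p ∈ S k, p.1 + 1 ≤ 2 * k) (F : ℕ × (ℕ → Site (d + 2)) → ℝ) :
    ∑ q ∈ ((S k ×ˢ Finset.range (2 * k)).filter fun q => OccU q.1.1 q.1.2 q.2), F q.1 = ∑ p ∈ S k, (uCount p.1 p.2 : ℝ) * F p := by
  rw [Finset.sum_filter, Finset.sum_product]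
  refine Finset.sum_congr rfl fun p hp => ?_
  rw [Finset.sum_ite, Finset.sum_const_zero, add_zero]
  dsimp only
  rw [Finset.sum_const, nsmul_eq_mul, filter_range_occU_eq_uSites (hlen p hp)]
  rfl

/-- Summing over `V`-pairs is summing `J · F` over members (`J(m,ω) = vCount m ω`). [cite: MadrasSlade1993, Theorem 7.3.2 (proof)] -/
theorem sum_vPairsG (hlen : ∀ p ∈ S k, p.1 + 1 ≤ 2 * k) (F : ℕ × (ℕ → Site (d + 2)) → ℝ) :
    ∑ q ∈ ((S k ×ˢ Finset.range (2 * k)).filter fun q => OccV q.1.1 q.1.2 q.2), F q.1 = ∑ p ∈ S k, (vCount p.1 p.2 : ℝ) * F p := by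
  rw [Finset.sum_filter, Finset.sum_product]
  refine Finset.sum_congr rfl fun p hp => ?_
  rw [Finset.sum_ite, Finset.sum_const_zero, add_zero]
  dsimp only
  rw [Finset.sum_const, nsmul_eq_mul, filter_range_occV_eq_vSites (hlen p hp)]
  rfl

/-- **"Counting the number of allowed pairs in two ways"** for a graded family closed under the swap at level
`k`: `((m, ω), i) ↦ ((m+2, ω'), i)` is a bijection from the allowed pairs of level `k` onto the `V`-pairs of level
`k + 1`. [cite: MadrasSlade1993, Theorem 7.3.2 (proof), eq. (7.3.6)] -/
theorem sum_uPairsG_eq_sum_vPairsG (hlen : ∀ p ∈ S k, p.1 + 1 ≤ 2 * k)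
    (hlen' : ∀ p ∈ S (k + 1), p.1 + 1 ≤ 2 * (k + 1))
    (hins : ∀ {i : ℕ} {p : ℕ × (ℕ → Site (d + 2))}, p ∈ S k → OccU p.1 p.2 i → (p.1 + 2, insV i p.2) ∈ S (k + 1))
    (hdel : ∀ {i : ℕ} {p : ℕ × (ℕ → Site (d + 2))}, p ∈ S (k + 1) → OccV p.1 p.2 i → (p.1 - 2, delV i p.2) ∈ S k)
    (F G : (ℕ × (ℕ → Site (d + 2))) × ℕ → ℝ)
    (h : ∀ q ∈ ((S k ×ˢ Finset.range (2 * k)).filter fun q => OccU q.1.1 q.1.2 q.2),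
      F q = G ((q.1.1 + 2, insV q.2 q.1.2), q.2)) :
    ∑ q ∈ ((S k ×ˢ Finset.range (2 * k)).filter fun q => OccU q.1.1 q.1.2 q.2), F q =
      ∑ q ∈ ((S (k + 1) ×ˢ Finset.range (2 * (k + 1))).filter fun q => OccV q.1.1 q.1.2 q.2), G q := by
  refine Finset.sum_nbij' (fun q => ((q.1.1 + 2, insV q.2 q.1.2), q.2))
    (fun q => ((q.1.1 - 2, delV q.2 q.1.2), q.2)) ?_ ?_ ?_ ?_ h
  · intro q hq
    obtain ⟨hp, hi⟩ := (mem_uPairsG hlen).1 hq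
    exact (mem_vPairsG hlen').2 ⟨hins hp hi, occV_insV hi⟩
  · intro q hq
    obtain ⟨hp, hi⟩ := (mem_vPairsG hlen').1 hq
    refine (mem_uPairsG hlen).2 ⟨hdel hp hi, ?_⟩
    have e : q.1.1 = q.1.1 - 2 + 2 := by have := hi.1; omega
    have hi' : OccV (q.1.1 - 2 + 2) q.1.2 q.2 := e ▸ hi
    exact occU_delV hi'
  · intro q hq
    obtain ⟨-, hi⟩ := (mem_uPairsG hlen).1 hq
    simp only [delV_insV hi, Nat.add_sub_cancel]
  · intro q hq
    obtain ⟨-, hi⟩ := (mem_vPairsG hlen').1 hq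
    have e : q.1.1 - 2 + 2 = q.1.1 := by have := hi.1; omega
    simp only [insV_delV hi, e]

/-- **(7.3.6), graded form**: `Σ_{(m,ω) ∈ S k} I/(J+1) = #{p' ∈ S (k+1) : J(p') ≥ 1}`.
[cite: MadrasSlade1993, Theorem 7.3.2 (proof), eq. (7.3.6)] -/
theorem sum_ratio_eq_cardG (hlen : ∀ p ∈ S k, p.1 + 1 ≤ 2 * k)
    (hlen' : ∀ p ∈ S (k + 1), p.1 + 1 ≤ 2 * (k + 1))
    (hins : ∀ {i : ℕ} {p : ℕ × (ℕ → Site (d + 2))}, p ∈ S k → OccU p.1 p.2 i → (p.1 + 2, insV i p.2) ∈ S (k + 1))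
    (hdel : ∀ {i : ℕ} {p : ℕ × (ℕ → Site (d + 2))}, p ∈ S (k + 1) → OccV p.1 p.2 i → (p.1 - 2, delV i p.2) ∈ S k) :
    ∑ p ∈ S k, (uCount p.1 p.2 : ℝ) / (vCount p.1 p.2 + 1) =
      (((S (k + 1)).filter fun p => 1 ≤ vCount p.1 p.2).card : ℝ) := by
  have h1 : ∑ p ∈ S k, (uCount p.1 p.2 : ℝ) / (vCount p.1 p.2 + 1) =
      ∑ q ∈ ((S k ×ˢ Finset.range (2 * k)).filter fun q => OccU q.1.1 q.1.2 q.2), 1 / ((vCount q.1.1 q.1.2 : ℝ) + 1) := by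
    rw [sum_uPairsG hlen (F := fun p => 1 / ((vCount p.1 p.2 : ℝ) + 1))]
    refine Finset.sum_congr rfl fun p _ => ?_
    rw [mul_one_div]
  have h2 : ∑ q ∈ ((S k ×ˢ Finset.range (2 * k)).filter fun q => OccU q.1.1 q.1.2 q.2), 1 / ((vCount q.1.1 q.1.2 : ℝ) + 1) =
      ∑ q ∈ ((S (k + 1) ×ˢ Finset.range (2 * (k + 1))).filter fun q => OccV q.1.1 q.1.2 q.2), 1 / (vCount q.1.1 q.1.2 : ℝ) := by
    refine sum_uPairsG_eq_sum_vPairsG hlen hlen' hins hdel _ (fun q => 1 / (vCount q.1.1 q.1.2 : ℝ)) fun q hq => ?_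
    obtain ⟨-, hi⟩ := (mem_uPairsG hlen).1 hq
    simp only [vCount_insV hi, Nat.cast_succ]
  have h3 : ∑ q ∈ ((S (k + 1) ×ˢ Finset.range (2 * (k + 1))).filter fun q => OccV q.1.1 q.1.2 q.2), 1 / (vCount q.1.1 q.1.2 : ℝ) =
      ∑ p ∈ S (k + 1), (vCount p.1 p.2 : ℝ) * (1 / (vCount p.1 p.2 : ℝ)) :=
    sum_vPairsG hlen' (F := fun p => 1 / (vCount p.1 p.2 : ℝ))
  rw [h1, h2, h3, Finset.card_eq_sum_ones, Nat.cast_sum, Finset.sum_filter]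
  refine Finset.sum_congr rfl fun p _ => ?_
  by_cases h : 1 ≤ vCount p.1 p.2
  · rw [if_pos h, mul_one_div_cancel]
    · simp
    · exact_mod_cast (show vCount p.1 p.2 ≠ 0 by omega)
  · rw [if_neg h, show vCount p.1 p.2 = 0 by omega]
    simp

/-- **(7.3.7), weak graded form**: `Σ_{S k} I(I−1)/((J+1)(J+2)) ≤ Σ_{S (k+1)} I/(J+1)`.
[cite: MadrasSlade1993, Theorem 7.3.2 (proof), eq. (7.3.7)] -/
theorem sum_ratio₂_leG (hlen : ∀ p ∈ S k, p.1 + 1 ≤ 2 * k)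
    (hlen' : ∀ p ∈ S (k + 1), p.1 + 1 ≤ 2 * (k + 1))
    (hins : ∀ {i : ℕ} {p : ℕ × (ℕ → Site (d + 2))}, p ∈ S k → OccU p.1 p.2 i → (p.1 + 2, insV i p.2) ∈ S (k + 1))
    (hdel : ∀ {i : ℕ} {p : ℕ × (ℕ → Site (d + 2))}, p ∈ S (k + 1) → OccV p.1 p.2 i → (p.1 - 2, delV i p.2) ∈ S k) :
    ∑ p ∈ S k, (uCount p.1 p.2 : ℝ) * ((uCount p.1 p.2 : ℝ) - 1) /
        (((vCount p.1 p.2 : ℝ) + 1) * ((vCount p.1 p.2 : ℝ) + 2)) ≤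
      ∑ p ∈ S (k + 1), (uCount p.1 p.2 : ℝ) / (vCount p.1 p.2 + 1) := by
  have h1 : ∑ p ∈ S k, (uCount p.1 p.2 : ℝ) * ((uCount p.1 p.2 : ℝ) - 1) /
        (((vCount p.1 p.2 : ℝ) + 1) * ((vCount p.1 p.2 : ℝ) + 2)) =
      ∑ q ∈ ((S k ×ˢ Finset.range (2 * k)).filter fun q => OccU q.1.1 q.1.2 q.2), ((uCount q.1.1 q.1.2 : ℝ) - 1) /
        (((vCount q.1.1 q.1.2 : ℝ) + 1) * ((vCount q.1.1 q.1.2 : ℝ) + 2)) := by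
    rw [sum_uPairsG hlen (F := fun p =>
      ((uCount p.1 p.2 : ℝ) - 1) / (((vCount p.1 p.2 : ℝ) + 1) * ((vCount p.1 p.2 : ℝ) + 2)))]
    refine Finset.sum_congr rfl fun p _ => ?_
    rw [mul_div_assoc]
  have h2 : ∑ q ∈ ((S k ×ˢ Finset.range (2 * k)).filter fun q => OccU q.1.1 q.1.2 q.2), ((uCount q.1.1 q.1.2 : ℝ) - 1) /
        (((vCount q.1.1 q.1.2 : ℝ) + 1) * ((vCount q.1.1 q.1.2 : ℝ) + 2)) =
      ∑ q ∈ ((S (k + 1) ×ˢ Finset.range (2 * (k + 1))).filter fun q => OccV q.1.1 q.1.2 q.2),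
        (uCount q.1.1 q.1.2 : ℝ) / ((vCount q.1.1 q.1.2 : ℝ) * ((vCount q.1.1 q.1.2 : ℝ) + 1)) := by
    refine sum_uPairsG_eq_sum_vPairsG hlen hlen' hins hdel _
      (fun q => (uCount q.1.1 q.1.2 : ℝ) / ((vCount q.1.1 q.1.2 : ℝ) * ((vCount q.1.1 q.1.2 : ℝ) + 1)))
      fun q hq => ?_
    obtain ⟨-, hi⟩ := (mem_uPairsG hlen).1 hq
    have hu : (uCount q.1.1 q.1.2 : ℝ) - 1 = uCount (q.1.1 + 2) (insV q.2 q.1.2) := by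
      rw [← uCount_insV hi]; push_cast; ring
    simp only [hu, vCount_insV hi, Nat.cast_succ]
    ring_nf
  have h3 : ∑ q ∈ ((S (k + 1) ×ˢ Finset.range (2 * (k + 1))).filter fun q => OccV q.1.1 q.1.2 q.2),
        (uCount q.1.1 q.1.2 : ℝ) / ((vCount q.1.1 q.1.2 : ℝ) * ((vCount q.1.1 q.1.2 : ℝ) + 1)) =
      ∑ p ∈ S (k + 1), (vCount p.1 p.2 : ℝ) *
        ((uCount p.1 p.2 : ℝ) / ((vCount p.1 p.2 : ℝ) * ((vCount p.1 p.2 : ℝ) + 1))) :=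
    sum_vPairsG hlen' (F := fun p =>
      (uCount p.1 p.2 : ℝ) / ((vCount p.1 p.2 : ℝ) * ((vCount p.1 p.2 : ℝ) + 1)))
  rw [h1, h2, h3]
  refine Finset.sum_le_sum fun p _ => ?_
  by_cases h : vCount p.1 p.2 = 0
  · rw [h]; simp
  · have hpos : (0 : ℝ) < vCount p.1 p.2 := by exact_mod_cast Nat.pos_of_ne_zero h
    rw [le_div_iff₀ (by positivity)]
    field_simp
    exact le_rfl

/-! ### The `Ξ`-term and the assembly (7.3.4) -/

/-- The bound on `Ξ` (7.3.10) at level `k` of a graded family: if at most `C |S k|/k³` members have `J < a k`, then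
`Σ [(I/(J+1))² − I(I−1)/((J+1)(J+2))] ≤ |S k| (4/a³ + 2/a² + 10C)/k` (all lengths `< 2k`, so `I, J ≤ 2k`).
[cite: MadrasSlade1993, Theorem 7.3.2 (proof, eq. (7.3.10))] -/
theorem sum_xi_leG (hlen : ∀ p ∈ S k, p.1 + 1 ≤ 2 * k) {a C : ℝ} (ha : 0 < a) (hk : 1 ≤ k)
    (hPT : ((((S k).filter fun p => (vCount p.1 p.2 : ℝ) < a * k).card : ℝ)) ≤ C * (S k).card / (k : ℝ) ^ 3) :
    ∑ p ∈ S k, ((uCount p.1 p.2 : ℝ) / ((vCount p.1 p.2 : ℝ) + 1)) ^ 2 -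
      ∑ p ∈ S k, (uCount p.1 p.2 : ℝ) * ((uCount p.1 p.2 : ℝ) - 1) /
        (((vCount p.1 p.2 : ℝ) + 1) * ((vCount p.1 p.2 : ℝ) + 2)) ≤
      (S k).card * ((4 / a ^ 3 + 2 / a ^ 2 + 10 * C) / k) := by
  have hk0 : (0 : ℝ) < k := by exact_mod_cast hk
  rw [← Finset.sum_sub_distrib]
  have key : ∀ p ∈ S k,
      ((uCount p.1 p.2 : ℝ) / ((vCount p.1 p.2 : ℝ) + 1)) ^ 2 -
        (uCount p.1 p.2 : ℝ) * ((uCount p.1 p.2 : ℝ) - 1) / (((vCount p.1 p.2 : ℝ) + 1) * ((vCount p.1 p.2 : ℝ) + 2)) ≤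
      (4 / a ^ 3 + 2 / a ^ 2) / k + 10 * (k : ℝ) ^ 2 * (if (vCount p.1 p.2 : ℝ) < a * k then 1 else 0) := by
    intro p hp
    have hl := hlen p hp
    refine xi_term_le ha hk (Nat.cast_nonneg _) ?_ (Nat.cast_nonneg _) ?_
    · have h1 : uCount p.1 p.2 ≤ p.1 + 1 := uCount_le
      have : (uCount p.1 p.2 : ℝ) ≤ 2 * k := by exact_mod_cast h1.trans hl
      exact this
    · have h1 : vCount p.1 p.2 ≤ p.1 + 1 := vCount_le
      have : (vCount p.1 p.2 : ℝ) ≤ 2 * k := by exact_mod_cast h1.trans hl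
      exact this
  refine (Finset.sum_le_sum key).trans ?_
  rw [Finset.sum_add_distrib, Finset.sum_const, nsmul_eq_mul, ← Finset.mul_sum, Finset.sum_boole]
  have h1 : 10 * (k : ℝ) ^ 2 * ((((S k).filter fun p => (vCount p.1 p.2 : ℝ) < a * k).card : ℝ)) ≤
      10 * (k : ℝ) ^ 2 * (C * (S k).card / k ^ 3) :=
    mul_le_mul_of_nonneg_left hPT (by positivity)
  have e : 10 * (k : ℝ) ^ 2 * (C * (S k).card / k ^ 3) = (S k).card * (10 * C / k) := by
    field_simp
  have e2 : ((S k).card : ℝ) * ((4 / a ^ 3 + 2 / a ^ 2) / k) + (S k).card * (10 * C / k) =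
      (S k).card * ((4 / a ^ 3 + 2 / a ^ 2 + 10 * C) / k) := by ring
  linarith

end Graded

section Assembly

open scoped Classical

variable {S : ℕ → Finset (ℕ × (ℕ → Site (d + 2)))}

/-- **Madras–Slade (7.3.4) for a graded family, swap-closed and pattern-rich from a threshold `k₀` on.**  Members of
`S k` are pairs `(m, ω)` with `m < 2k`; closure: an occurrence of `(U,Q)` on a member of `S k` may be swapped into one
of `(V,Q)` landing in `S (k+1)` (length `+2`), and back.  If at most `C|S k|/k³` members of `S k` have fewer than `a k`
occurrences of `(V,Q)` and the `S_N`-term obeys `3|S(k+1)|·#{J = 0 in S(k+1)}/|S k|² ≤ C'/k` eventually, then with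
`φ_k = |S (k+1)|/|S k|`: `φ_k² − D/k ≤ φ_k φ_{k+1}` eventually, `D = 4/a³ + 2/a² + 10C + C'`.
[cite: MadrasSlade1993, Theorem 7.3.2 (proof, eqs. (7.3.4)–(7.3.12))] -/
theorem kesten_ineq_graded (k₀ : ℕ)
    (hlen : ∀ k, ∀ p ∈ S k, p.1 + 1 ≤ 2 * k)
    (hins : ∀ {k i : ℕ} {p : ℕ × (ℕ → Site (d + 2))}, k₀ ≤ k → p ∈ S k → OccU p.1 p.2 i →
      (p.1 + 2, insV i p.2) ∈ S (k + 1))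
    (hdel : ∀ {k i : ℕ} {p : ℕ × (ℕ → Site (d + 2))}, k₀ ≤ k → p ∈ S (k + 1) → OccV p.1 p.2 i →
      (p.1 - 2, delV i p.2) ∈ S k)
    (hpos : ∀ k, k₀ ≤ k → 0 < (S k).card) {a C C' : ℝ} (ha : 0 < a)
    (hPT : ∀ k : ℕ, k₀ ≤ k → 1 ≤ k →
      ((((S k).filter fun p => (vCount p.1 p.2 : ℝ) < a * k).card : ℝ)) ≤ C * (S k).card / (k : ℝ) ^ 3)
    (hS : ∀ᶠ k : ℕ in atTop,
      3 * ((S (k + 1)).card : ℝ) * (((S (k + 1)).filter fun p => ¬ 1 ≤ vCount p.1 p.2).card : ℝ) /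
        ((S k).card : ℝ) ^ 2 ≤ C' / k) :
    ∀ᶠ k : ℕ in atTop,
      (((S (k + 1)).card : ℝ) / (S k).card) ^ 2 - (4 / a ^ 3 + 2 / a ^ 2 + 10 * C + C') / k ≤
        (((S (k + 1)).card : ℝ) / (S k).card) * (((S (k + 2)).card : ℝ) / (S (k + 1)).card) := by
  have hcpos : ∀ m, k₀ ≤ m → (0 : ℝ) < (S m).card := fun m hm => by exact_mod_cast hpos m hm
  obtain ⟨K, hK⟩ : ∃ K : ℝ, K = 4 / a ^ 3 + 2 / a ^ 2 := ⟨_, rfl⟩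
  filter_upwards [eventually_ge_atTop 1, eventually_ge_atTop k₀, hS] with N hN hNk₀ hSN
  have hN0 : (0 : ℝ) < N := by exact_mod_cast hN
  have hinsN : ∀ {i : ℕ} {p : ℕ × (ℕ → Site (d + 2))}, p ∈ S N → OccU p.1 p.2 i →
      (p.1 + 2, insV i p.2) ∈ S (N + 1) := fun hp hi => hins hNk₀ hp hi
  have hdelN : ∀ {i : ℕ} {p : ℕ × (ℕ → Site (d + 2))}, p ∈ S (N + 1) → OccV p.1 p.2 i →
      (p.1 - 2, delV i p.2) ∈ S N := fun hp hi => hdel hNk₀ hp hi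
  have hinsN1 : ∀ {i : ℕ} {p : ℕ × (ℕ → Site (d + 2))}, p ∈ S (N + 1) → OccU p.1 p.2 i →
      (p.1 + 2, insV i p.2) ∈ S (N + 1 + 1) := fun hp hi => hins (by omega) hp hi
  have hdelN1 : ∀ {i : ℕ} {p : ℕ × (ℕ → Site (d + 2))}, p ∈ S (N + 1 + 1) → OccV p.1 p.2 i →
      (p.1 - 2, delV i p.2) ∈ S (N + 1) := fun hp hi => hdel (by omega) hp hi
  obtain ⟨cN, hcN_def⟩ : ∃ x : ℝ, x = (S N).card := ⟨_, rfl⟩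
  obtain ⟨cN2, hcN2_def⟩ : ∃ x : ℝ, x = (S (N + 1)).card := ⟨_, rfl⟩
  obtain ⟨cN4, hcN4_def⟩ : ∃ x : ℝ, x = (S (N + 2)).card := ⟨_, rfl⟩
  have hcN : 0 < cN := hcN_def ▸ hcpos N hNk₀
  have hcN2 : 0 < cN2 := hcN2_def ▸ hcpos (N + 1) (by omega)
  obtain ⟨A, hA⟩ : ∃ x : ℝ, x = ∑ p ∈ S N, (uCount p.1 p.2 : ℝ) / (vCount p.1 p.2 + 1) := ⟨_, rfl⟩
  obtain ⟨Cq, hCq⟩ : ∃ x : ℝ,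
      x = ∑ p ∈ S N, ((uCount p.1 p.2 : ℝ) / ((vCount p.1 p.2 : ℝ) + 1)) ^ 2 := ⟨_, rfl⟩
  obtain ⟨B, hB⟩ : ∃ x : ℝ, x = ∑ p ∈ S N,
      (uCount p.1 p.2 : ℝ) * ((uCount p.1 p.2 : ℝ) - 1) / (((vCount p.1 p.2 : ℝ) + 1) * ((vCount p.1 p.2 : ℝ) + 2)) :=
    ⟨_, rfl⟩
  obtain ⟨W₁, hW₁⟩ : ∃ x : ℕ, x = ((S (N + 1)).filter fun p => 1 ≤ vCount p.1 p.2).card := ⟨_, rfl⟩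
  obtain ⟨Z, hZ⟩ : ∃ x : ℕ, x = ((S (N + 1)).filter fun p => ¬ 1 ≤ vCount p.1 p.2).card := ⟨_, rfl⟩
  -- (a) `A = #{J ≥ 1 in S (N+1)}` (7.3.6)
  have ha' : A = W₁ := by
    rw [hA, hW₁]; exact sum_ratio_eq_cardG (hlen N) (hlen (N + 1)) hinsN hdelN
  -- (b) `|S (N+1)| = #{J ≥ 1} + #{J = 0}`
  have hb : cN2 = W₁ + Z := by
    have h := Finset.card_filter_add_card_filter_not (s := S (N + 1)) (fun p => 1 ≤ vCount p.1 p.2)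
    rw [hcN2_def, ← h, Nat.cast_add, hW₁, hZ]
  -- (c) `B ≤ |S (N+2)|` (7.3.7)
  have hc : B ≤ cN4 := by
    rw [hB, hcN4_def]
    refine (sum_ratio₂_leG (hlen N) (hlen (N + 1)) hinsN hdelN).trans ?_
    rw [sum_ratio_eq_cardG (hlen (N + 1)) (hlen (N + 1 + 1)) hinsN1 hdelN1]
    exact_mod_cast Finset.card_filter_le _ _
  -- (d) Schwarz (7.3.8)
  have hd : A ^ 2 ≤ cN * Cq := by
    have h := sq_sum_le_card_mul_sum_sq (s := S N)
      (f := fun p => (uCount p.1 p.2 : ℝ) / ((vCount p.1 p.2 : ℝ) + 1))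
    rw [hA, hcN_def, hCq]
    exact h
  -- (e) the term `Ξ`
  have he : Cq - B ≤ cN * ((K + 10 * C) / N) := by
    rw [hCq, hB, hcN_def, hK]
    exact sum_xi_leG (hlen N) ha hN (hPT N hNk₀ hN)
  -- (f) the term `S_N`
  have hf : 3 * cN2 * Z / cN ^ 2 ≤ C' / N := by rw [hcN2_def, hZ, hcN_def]; exact hSN
  ---- assembling
  have hφ : (((S (N + 1)).card : ℝ) / (S N).card) * (((S (N + 2)).card : ℝ) / (S (N + 1)).card) =
      cN4 / cN := by
    rw [← hcN_def, ← hcN2_def, ← hcN4_def]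
    field_simp
  rw [hφ, ← hcN_def, ← hcN2_def]
  have hZ0 : (0 : ℝ) ≤ Z := Nat.cast_nonneg _
  have hA_le : A ≤ cN2 := by rw [ha', hb]; linarith
  have h1 : cN2 ^ 2 ≤ cN * Cq + 3 * cN2 * Z := by
    have e : cN2 = A + Z := by rw [hb, ha']
    calc cN2 ^ 2 = A ^ 2 + (2 * A + Z) * Z := by rw [e]; ring
      _ ≤ cN * Cq + (2 * cN2 + cN2) * Z := by
          have : (2 * A + Z) * Z ≤ (2 * cN2 + cN2) * Z :=
            mul_le_mul_of_nonneg_right (by linarith) hZ0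
          linarith
      _ = cN * Cq + 3 * cN2 * Z := by ring
  have h2 : (cN2 / cN) ^ 2 ≤ Cq / cN + 3 * cN2 * Z / cN ^ 2 := by
    have e : Cq / cN + 3 * cN2 * Z / cN ^ 2 = (cN * Cq + 3 * cN2 * Z) / cN ^ 2 := by
      field_simp
    rw [e, div_pow]
    exact div_le_div_of_nonneg_right h1 (by positivity)
  have h3 : B / cN ≤ cN4 / cN := div_le_div_of_nonneg_right hc hcN.le
  have h4 : Cq / cN - B / cN ≤ (K + 10 * C) / N := by
    rw [← sub_div, div_le_iff₀ hcN]
    linarith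
  have h6 : (K + 10 * C + C') / (N : ℝ) = (K + 10 * C) / N + C' / N := by ring
  rw [hK] at h4 h6
  rw [h6]
  linarith

end Assembly

end Summit.CriticalPhenomena.PercolationContinuityZ3.Theorems.Pcint.MemoryTail
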